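import Literature.Computability.AlgebraicComplexity.MS2001Example521
import Literature.Computability.AlgebraicComplexity.PerStabilizerMarcusMayAllFields
import Literature.Computability.AlgebraicComplexity.MS2001StableObstructionMultiplicityAllFields
import Literature.Computability.AlgebraicComplexity.MS2001KempfStabilityHolds
import HarnessLib

/-!
# GCT I, Example 5.2.1: the obstruction `Sym^{ad}(X)` over every field of characteristic `0`
# (Mulmuley–Sohoni 2001)

Cell `val-lit` (D-0074 GROUP L), row MS2001-A, typer `val-lit-t01`. THEOREMS ONLY (no definition,
no named fact; D-0026). Companion of `MS2001Example521.lean`, which proves GCT I §5.2.1 Example 1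
(authors' version pp. 21–22, all.txt L1491–1517) over `ℂ`:
`W = Sym^{ad}(X)`, `a > 1`, is a Thm.-5.1 obstruction for `(perm_d, det_d)` under `SL_{d²}`
(`dim W^Q = 1 < 2 ≤ dim W^H`), hence `perm_d ∉ Δ[det_d]` (`d ≥ 3`; over every field of
characteristic `0` by base change, `MS2001_example_5_2_1_charZero`, val-lit t02 g9).

There the `det` side (Q) is already proved over every infinite field, and the two `H`-fixed forms
are independent over every field of characteristic `0`; only the `H`-invariance of
"the permanent of the matrix obtained by replacing each entry of `X` by its `a`th power" used the
Marcus–May description of `Stab(perm_d)`, typed in the tree over `ℂ`. With Marcus–May now available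
over every infinite field of characteristic `≠ 2` (`PerStabilizerMarcusMayAllFields.lean`,
`marcusMay1962_perPreserver_sandwich_of_charZero`), this file records:

* `MS2001Example521.bind₁_pow_perPoly_mem_fixedForms_of_charZero` — `perm(X^{∘a}) ∈ W^H` over every
  field of characteristic `0` (`d ≥ 3`);
* `MS2001Example521.two_le_finrank_fixedForms_slSubgroup_perPoly_mul_of_charZero` and
  **`MS2001_example_5_2_1_obstruction_charZero`** — "any `Sym^r(X)`, `r = ad`, `a > 1`, is an
  obstruction for the pair `(f, g)`" as the typed Thm.-5.1 hypothesis
  `dim (Sym^{da})^{SL ∩ Stab(det_d)} < dim (Sym^{da})^{SL ∩ Stab(perm_d)}` over EVERY field of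
  characteristic `0` (`d ≥ 3`, `a ≥ 2`);
* a closing `example` (no declaration): the conclusion `perm_d ∉ Δ[det_d]` over every
  algebraically closed field of characteristic `0` is a DIRECT instance of the tree's theorems
  `MS2001_thm_5_1_holds` (GCT I Thm. 5.1 for all such fields, `MS2001StableObstructionMultiplicityAllFields.lean`)
  and `MS2001_thm_4_7_holds` (stability of `perm_d`, `MS2001KempfStabilityHolds.lean`) applied to the
  obstruction above — MS's own sentence "By Theorem 5.1, any `Sym^r(X)` … is an obstruction" at the
  print's generality ("algebraically closed base field of characteristic zero", AV p. 20 L1392). The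
  STATEMENT over every field of characteristic `0` is already the tree's
  `MS2001_example_5_2_1_charZero` (`MS2001Example521.lean`, val-lit t02 g9, by base change from `ℂ`
  along `ℚ ⊆ F`, `ℚ ⊆ ℂ`) and is not restated here; the example only records that the route through
  the all-fields Thm. 5.1 does not pass through `ℂ`.

Honest framing: a 2001 worked example; `perm_d ∉ Δ[det_d]` is classical. VP ≠ VNP is NOT proved
and nothing here bears on it.

## References

* [MulmuleySohoniSIAM2001] K. D. Mulmuley, M. Sohoni, *Geometric complexity theory I*, SIAM J.
  Comput. 31 (2001) 496–526; AV §5.2.1 Example 1, pp. 21–22 (all.txt L1491–1517); Thm. 5.1 p. 20;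
  Thm. 4.7 p. 15.
* [MarcusMay1962] M. Marcus, F. C. May, *The permanent function*, Canad. J. Math. 14 (1962), §2
  Theorem; tree `marcusMay1962_perPreserver_sandwich_of_charZero`.
-/

noncomputable section

open MvPolynomial Matrix Finset

namespace Literature.Computability.AlgebraicComplexity

namespace MS2001Example521

/-! ## §0 Private helpers (copies of the `ℂ` file's plumbing, over any commutative ring) -/

/-- `(M · f)(x) = f(Mᵀ x)`. [folklore] -/
private theorem eval_linSubst'' {σ R : Type*} [Fintype σ] [CommRing R] (M : Matrix σ σ R) (x : σ → R)
    (f : MvPolynomial σ R) : eval x (linSubst σ R M f) = eval (Mᵀ *ᵥ x) f := by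
  induction f using MvPolynomial.induction_on with
  | C a => rw [linSubst_C, eval_C, eval_C]
  | add p q hp hq => rw [map_add, map_add, map_add, hp, hq]
  | mul_X p i hp =>
    rw [map_mul, map_mul, map_mul, hp, linSubst_X, eval_X]
    congr 1
    simp [Matrix.mulVec, dotProduct, smul_eval]

/-- Entries of a monomial sandwich. [folklore] -/
private theorem sandwich_apply'' {ι R : Type*} [Fintype ι] [DecidableEq ι] [CommRing R]
    (dd l : ι → R) (π ρ : Equiv.Perm ι) (X : Matrix ι ι R) (i j : ι) :
    (diagonal dd * π.permMatrix R * X * ρ.permMatrix R * diagonal l) i j =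
      dd i * X (π i) (ρ.symm j) * l j := by
  rw [Matrix.mul_diagonal, PEquiv.mul_toMatrix_toPEquiv, Matrix.submatrix_apply, id,
    Matrix.mul_assoc, Matrix.diagonal_mul, PEquiv.toMatrix_toPEquiv_mul, Matrix.submatrix_apply, id]

/-- Entrywise powers commute with monomial sandwiches. [folklore] -/
private theorem hadamardPow_sandwich'' {ι R : Type*} [Fintype ι] [DecidableEq ι] [CommRing R]
    (dd l : ι → R) (π ρ : Equiv.Perm ι) (X : Matrix ι ι R) (a : ℕ) :
    (Matrix.of fun i j => (diagonal dd * π.permMatrix R * X * ρ.permMatrix R * diagonal l) i j ^ a) =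
      diagonal (fun i => dd i ^ a) * π.permMatrix R * (Matrix.of fun i j => X i j ^ a) *
        ρ.permMatrix R * diagonal (fun j => l j ^ a) := by
  ext i j
  rw [Matrix.of_apply, sandwich_apply'', sandwich_apply'', Matrix.of_apply, mul_pow, mul_pow]

/-- `∏ dᵢ^a · ∏ lⱼ^a = 1` under the Marcus–May normalisation. [folklore] -/
private theorem prod_pow_mul_prod_pow_eq_one'' {R : Type*} [CommRing R] {d : ℕ} {dd l : Fin d → R}
    (hdl : (∏ i, dd i) * (∏ i, l i) = 1) (a : ℕ) :
    (∏ i, dd i ^ a) * (∏ i, l i ^ a) = 1 := by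
  rw [Finset.prod_pow, Finset.prod_pow, ← mul_pow, hdl, one_pow]

/-! ## §1 The `perm` side over every field of characteristic `0` -/

/-- **"and so too the permanent of the matrix obtained by replacing each entry of `X` by its `a`th
power"** (MS 2001, §5.2.1, AV p.22 L1508–1509) over EVERY field of characteristic `0`: for `d ≥ 3`,
`perm(X^{∘a}) ∈ fixedForms (slSubgroup _ F) perm_d (d a)`; as in the `ℂ` theorem
`bind₁_pow_perPoly_mem_fixedForms`, with the Marcus–May shape of `Stab(perm_d)` now over `F`
(`marcusMay1962_perPreserver_sandwich_of_charZero`).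
[cite: MulmuleySohoniSIAM2001, §5.2.1 Example 1 (AV p.22, all.txt L1507–1509)]
[cite: MarcusMay1962, §2 Theorem, p. 179] -/
theorem bind₁_pow_perPoly_mem_fixedForms_of_charZero (F : Type*) [Field F] [CharZero F] {d : ℕ}
    (hd : 3 ≤ d) (a : ℕ) :
    bind₁ (fun p : Fin d × Fin d => (X p : MvPolynomial (Fin d × Fin d) F) ^ a) (perPoly (Fin d) F) ∈
      fixedForms (slSubgroup (Fin d × Fin d) F) (perPoly (Fin d) F) (d * a) := by
  refine mem_fixedForms_iff.mpr ⟨bind₁_pow_perPoly_isHomogeneous a, fun γ _ hγ => ?_⟩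
  obtain ⟨π, ρ, dd, l, hdl, hcase⟩ :=
    marcusMay1962_perPreserver_sandwich_of_charZero F hd
      ((mem_linStabilizer (f := perPoly (Fin d) F)).mpr hγ)
  apply MvPolynomial.funext
  intro x
  rw [linSubstRep_apply, eval_linSubst'', eval_bind₁_pow_perPoly, eval_bind₁_pow_perPoly]
  rcases hcase with hM | hM
  · have hmat : (Matrix.of fun i j : Fin d =>
        ((γ : Matrix (Fin d × Fin d) (Fin d × Fin d) F)ᵀ *ᵥ x) (i, j) ^ a) =
        Matrix.of fun i j : Fin d => (diagonal dd * π.permMatrix F *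
          (Matrix.of fun i j : Fin d => x (i, j)) * ρ.permMatrix F * diagonal l) i j ^ a := by
      ext i j
      have h := congr_fun (congr_fun (hM x) i) j
      rw [Matrix.of_apply] at h
      rw [Matrix.of_apply, Matrix.of_apply, h]
    have hX : (Matrix.of fun i j : Fin d => (Matrix.of fun i j : Fin d => x (i, j)) i j ^ a) =
        Matrix.of fun i j : Fin d => x (i, j) ^ a := by
      ext i j; rfl
    rw [hmat, hadamardPow_sandwich'', hX, MarcusMay.permanent_sandwich,
      prod_pow_mul_prod_pow_eq_one'' hdl, one_mul]
  · have hmat : (Matrix.of fun i j : Fin d =>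
        ((γ : Matrix (Fin d × Fin d) (Fin d × Fin d) F)ᵀ *ᵥ x) (i, j) ^ a) =
        Matrix.of fun i j : Fin d => (diagonal dd * π.permMatrix F *
          (Matrix.of fun i j : Fin d => x (i, j))ᵀ * ρ.permMatrix F * diagonal l) i j ^ a := by
      ext i j
      have h := congr_fun (congr_fun (hM x) i) j
      rw [Matrix.of_apply] at h
      rw [Matrix.of_apply, Matrix.of_apply, h]
    have hT : (Matrix.of fun i j : Fin d => (Matrix.of fun i j : Fin d => x (i, j))ᵀ i j ^ a) =
        (Matrix.of fun i j : Fin d => x (i, j) ^ a)ᵀ := by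
      ext i j; rfl
    rw [hmat, hadamardPow_sandwich'', hT, MarcusMay.permanent_sandwich_transpose,
      prod_pow_mul_prod_pow_eq_one'' hdl, one_mul]

/-- **(H) over every field of characteristic `0`: "The multiplicity of the trivial
`H`-representation in `W` exceeds one"** (MS 2001, §5.2.1, AV p.22 L1506–1509), `W = Sym^{da}(X)`,
`H = SL_{d²} ∩ Stab(perm_d)`, `d ≥ 3`, `a ≥ 2`: `2 ≤ finrank (fixedForms (slSubgroup _ F) perm_d (d a))`.
[cite: MulmuleySohoniSIAM2001, §5.2.1 Example 1 (AV p.22, all.txt L1506–1509)]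
[cite: MarcusMay1962, §2 Theorem, p. 179] -/
theorem two_le_finrank_fixedForms_slSubgroup_perPoly_mul_of_charZero (F : Type*) [Field F]
    [CharZero F] {d : ℕ} (hd : 3 ≤ d) {a : ℕ} (ha : 2 ≤ a) :
    2 ≤ Module.finrank F (fixedForms (slSubgroup (Fin d × Fin d) F) (perPoly (Fin d) F) (d * a)) := by
  have hli := linearIndependent_pow_perPoly_bind₁ (k := F) (d := d) (by omega) ha
  have hle : Submodule.span F (Set.range ![(perPoly (Fin d) F) ^ a,
      bind₁ (fun p : Fin d × Fin d => (X p : MvPolynomial (Fin d × Fin d) F) ^ a) (perPoly (Fin d) F)]) ≤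
      fixedForms (slSubgroup (Fin d × Fin d) F) (perPoly (Fin d) F) (d * a) := by
    rw [Submodule.span_le]
    rintro _ ⟨i, rfl⟩
    fin_cases i
    · simpa using pow_perPoly_mem_fixedForms (k := F) (d := d) a
    · simpa using bind₁_pow_perPoly_mem_fixedForms_of_charZero F hd a
  haveI : Module.Finite F ↥(homogeneousSubmodule (Fin d × Fin d) F (d * a)) :=
    finite_homogeneousSubmodule _ F _
  haveI : Module.Finite F ↥(fixedForms (slSubgroup (Fin d × Fin d) F) (perPoly (Fin d) F) (d * a)) :=
    Submodule.finiteDimensional_of_le (fun p hp => hp.1)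
  calc 2 = Module.finrank F (Submodule.span F (Set.range ![(perPoly (Fin d) F) ^ a,
      bind₁ (fun p : Fin d × Fin d => (X p : MvPolynomial (Fin d × Fin d) F) ^ a)
        (perPoly (Fin d) F)])) := by rw [finrank_span_eq_card hli]; simp
    _ ≤ _ := Submodule.finrank_mono hle

end MS2001Example521

open MS2001Example521

/-! ## §2 The obstruction over every field of characteristic `0`, and the conclusion over every
algebraically closed one -/

/-- **GCT I, Example 5.2.1 — "any `Sym^r(X)`, `r = ad`, `a > 1`, is an obstruction for the pair
`(f, g)`"** (`f = perm_d`, `g = det_d`; AV p.22 L1516–1517) as the typed Thm.-5.1 hypothesis, over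
EVERY field `F` of characteristic `0` (`d ≥ 3`, `a ≥ 2`):
`dim (Sym^{da})^{SL ∩ Stab(det_d)} = 1 < 2 ≤ dim (Sym^{da})^{SL ∩ Stab(perm_d)}`.
[cite: MulmuleySohoniSIAM2001, §5.2.1 Example 1 (AV pp.21–22, all.txt L1491–1517)] -/
theorem MS2001_example_5_2_1_obstruction_charZero (F : Type*) [Field F] [CharZero F] {d : ℕ}
    (hd : 3 ≤ d) {a : ℕ} (ha : 2 ≤ a) :
    Module.finrank F (fixedForms (slSubgroup (Fin d × Fin d) F) (detPoly (Fin d) F) (d * a)) <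
      Module.finrank F (fixedForms (slSubgroup (Fin d × Fin d) F) (perPoly (Fin d) F) (d * a)) := by
  rw [finrank_fixedForms_slSubgroup_detPoly_mul]
  exact lt_of_lt_of_le one_lt_two
    (two_le_finrank_fixedForms_slSubgroup_perPoly_mul_of_charZero F hd ha)

/-- GCT I, Example 5.2.1 over an algebraically closed field of characteristic `0` as a DIRECT
instance of the all-fields theorems `MS2001_thm_5_1_holds` (Thm. 5.1) and `MS2001_thm_4_7_holds`
(Thm. 4.7: `perm_d` is stable) applied to the obstruction `W = Sym^{2d}(X)`
(`MS2001_example_5_2_1_obstruction_charZero`). Not a declaration: the statement, over every field of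
characteristic `0`, is the tree's `MS2001_example_5_2_1_charZero` (base change from `ℂ`).
[cite: MulmuleySohoniSIAM2001, §5.2.1 Example 1 (AV pp.21–22); Thm. 5.1 (AV p.20); Thm. 4.7 (AV p.15)] -/
example (F : Type) [Field F] [IsAlgClosed F] [CharZero F] {d : ℕ}
    (hd : 3 ≤ d) : perPoly (Fin d) F ∉ orbitClosure (detPoly (Fin d) F) := by
  have hper : (perPoly (Fin d) F).IsHomogeneous d := by
    simpa using perPoly_isHomogeneous (n := Fin d) (k := F)
  have hdet : (detPoly (Fin d) F).IsHomogeneous d := by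
    simpa using detPoly_isHomogeneous (n := Fin d) (k := F)
  exact MS2001_thm_5_1_holds F (Fin d × Fin d) (perPoly (Fin d) F) (detPoly (Fin d) F) d hper hdet
    (MS2001_thm_4_7_holds F d) ⟨d * 2, MS2001_example_5_2_1_obstruction_charZero F hd le_rfl⟩

end Literature.Computability.AlgebraicComplexity

end
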